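import Summits.Ventures.PercRepro.SixFourPLProfile

/-!
# PercRepro — C-025 at `(6,4)`, §22.12.2 (a): the planes of a plane-line set (p3, gen 9)

mine-2's `MINE2-RLS.md` Lemma PL-LIST 22.12.2 (a): for a normalisation `D : PLData M G` of a plane-line set, every
plane `P` of `M` whose trace `P ∩ G` has rank `3` is one of
* `P₀` (when `P ∩ L = ∅`: the trace lies in `ρ`, so `P = cl(P ∩ G) ⊆ P₀`);
* `Π_y` for some `y ∈ ρ ∖ ℓ` (when `|P ∩ L| ≥ 2`: two points of `L` span `ℓ ⊆ P`, and a point `y` of the trace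
  outside `ℓ` gives `P = cl(L ∪ {y})`);
* `cl({x} ∪ λ)` with `P ∩ L = {x}` and `λ = P ∩ ρ` a rank-`2` trace of `ρ` that is NOT a class (the trace is
  `{x} ∪ λ`, `ρ(λ) = 2`, and `λ = λ_y` would force `P = Π_y ⊇ L`).

`plane_trichotomy` is the statement; the line profiles of the three kinds (22.12.2 (b)) and the resulting bound
`Σ_planes cost ≤ Σ_{𝒫(π)} cost` are the next files of the `PLJlow` path.
-/

namespace PercRepro.SixFour

open Finset ThmH

variable {α : Type*} [DecidableEq α] {M : Matroid α} [M.Finite] {G : Finset α}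

namespace PLData

variable {D : PLData M G}

/-- A plane whose trace has rank `3` is the closure of its trace. -/
theorem plane_eq_clF_trace {P : Finset α} (hP : P ∈ planes M) (h3 : M.eRk ((P ∩ G : Finset α) : Set α) = 3) :
    P = clF M (P ∩ G) := by
  apply Finset.coe_injective
  rw [coe_clF]
  exact (closure_eq_of_subset_plane hP Finset.inter_subset_left h3).symm

/-- Case `P ∩ L = ∅`: the plane is `P₀`. -/
theorem plane_eq_P₀_of_inter_L_empty {P : Finset α} (hP : P ∈ planes M)
    (h3 : M.eRk ((P ∩ G : Finset α) : Set α) = 3) (hL : P ∩ D.L = ∅) : P = D.P₀ := by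
  have hsub : P ∩ G ⊆ D.P₀ := by
    intro z hz
    rw [Finset.mem_inter] at hz
    by_contra hzP
    have : z ∈ P ∩ D.L := Finset.mem_inter.2 ⟨hz.1, Finset.mem_sdiff.2 ⟨hz.2, hzP⟩⟩
    rw [hL] at this
    exact Finset.notMem_empty z this
  exact planes_eq_of_subset hP D.plane Finset.inter_subset_left hsub h3

/-- Case `|P ∩ L| ≥ 2`: the plane is some `Π_y` with `y ∈ ρ ∖ ℓ`. -/
theorem plane_eq_Pi_of_two_le (hs : Simple M) (hG : G ⊆ gr M) (h2 : 2 ≤ D.L.card) {P : Finset α}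
    (hP : P ∈ planes M) (h3 : M.eRk ((P ∩ G : Finset α) : Set α) = 3) (hL : 2 ≤ (P ∩ D.L).card) :
    ∃ y ∈ D.ρ \ D.ellF, P = D.Pi y := by
  -- `ℓ ⊆ P`: two points of `L` in `P` span `cl(L)`
  obtain ⟨a, ha, b, hb, hab⟩ := Finset.one_lt_card.1 hL
  rw [Finset.mem_inter] at ha hb
  have hℓP : D.ellF ⊆ P := by
    unfold ellF
    rw [← Finset.coe_subset, coe_clF, ← closure_pair_eq_of_eRk_le_two hs (D.L_subset.trans hG) D.rank_rest ha.2 hb.2 hab]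
    calc M.closure (({a, b} : Finset α) : Set α) ⊆ M.closure (P : Set α) := by
          apply M.closure_subset_closure
          intro z hz
          rw [Finset.mem_coe, Finset.mem_insert, Finset.mem_singleton] at hz
          rcases hz with rfl | rfl
          · exact ha.1
          · exact hb.1
      _ = (P : Set α) := (mem_planes.1 hP).2.1.closure
  -- a point of the trace outside `ℓ`
  have hne : ∃ y ∈ P ∩ G, y ∉ D.ellF := by
    by_contra h
    push Not at h
    have hsub : P ∩ G ⊆ D.ellF := fun y hy => h y hy
    have := M.eRk_mono (Finset.coe_subset.2 hsub)
    rw [h3, (mem_lines.1 (D.ellF_mem_lines hs hG h2).1).2.2] at this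
    exact absurd this (by decide)
  obtain ⟨y, hy, hyℓ⟩ := hne
  rw [Finset.mem_inter] at hy
  have hyρ := mem_ρ_of_notMem_ellF hs hG h2 hy.2 hyℓ
  refine ⟨y, Finset.mem_sdiff.2 ⟨hyρ, hyℓ⟩, ?_⟩
  have hPi := Pi_mem_planes hs hG h2 hy.2 hyℓ
  have hsub : insert y D.L ⊆ P := Finset.insert_subset hy.1 ((D.L_subset_ellF hs hG h2).trans hℓP)
  exact planes_eq_of_subset hP hPi.1 hsub hPi.2 (eRk_insert_L_eq_three hs hG h2 hy.2 hyℓ)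

/-- Case `P ∩ L = {x}`: the trace is `{x} ∪ λ` with `λ = P ∩ ρ` of rank `2`, and `λ` is not a class. -/
theorem plane_trace_of_inter_L_singleton (hs : Simple M) (hG : G ⊆ gr M) (h2 : 2 ≤ D.L.card) {P : Finset α}
    (hP : P ∈ planes M) (h3 : M.eRk ((P ∩ G : Finset α) : Set α) = 3) {x : α} (hL : P ∩ D.L = {x}) :
    x ∈ D.L ∧ P ∩ G = insert x (P ∩ D.ρ) ∧ M.eRk ((P ∩ D.ρ : Finset α) : Set α) = 2 ∧
      P ∩ D.ρ ∉ D.classes := by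
  have hxL : x ∈ D.L := by
    have : x ∈ P ∩ D.L := by rw [hL]; exact Finset.mem_singleton_self x
    exact (Finset.mem_inter.1 this).2
  have hxP : x ∈ P := by
    have : x ∈ P ∩ D.L := by rw [hL]; exact Finset.mem_singleton_self x
    exact (Finset.mem_inter.1 this).1
  have htrace : P ∩ G = insert x (P ∩ D.ρ) := by
    ext z
    rw [Finset.mem_inter, Finset.mem_insert, Finset.mem_inter]
    constructor
    · rintro ⟨hzP, hzG⟩
      by_cases hzP₀ : z ∈ D.P₀
      · exact Or.inr ⟨hzP, Finset.mem_inter.2 ⟨hzP₀, hzG⟩⟩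
      · left
        have : z ∈ P ∩ D.L := Finset.mem_inter.2 ⟨hzP, Finset.mem_sdiff.2 ⟨hzG, hzP₀⟩⟩
        rw [hL] at this
        exact Finset.mem_singleton.1 this
    · rintro (rfl | ⟨hzP, hzρ⟩)
      · exact ⟨hxP, D.L_subset hxL⟩
      · exact ⟨hzP, D.ρ_subset hzρ⟩
  have hxP₀ : x ∉ D.P₀ := (Finset.mem_sdiff.1 hxL).2
  have hne : P ≠ D.P₀ := fun h => hxP₀ (h ▸ hxP)
  -- `P ∩ ρ` has rank `2`
  have hr2 : M.eRk ((P ∩ D.ρ : Finset α) : Set α) = 2 := by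
    apply le_antisymm
    · calc M.eRk ((P ∩ D.ρ : Finset α) : Set α) ≤ M.eRk ((P ∩ D.P₀ : Finset α) : Set α) := by
            apply M.eRk_mono
            apply Finset.coe_subset.2
            exact Finset.inter_subset_inter (Finset.Subset.refl _) Finset.inter_subset_left
        _ ≤ 2 := eRk_inter_le_two_of_ne hP D.plane hne
    · have h := M.eRk_insert_le_add_one x ((P ∩ D.ρ : Finset α) : Set α)
      rw [← Finset.coe_insert, ← htrace, h3] at h
      obtain ⟨k, hk, -⟩ := eRk_eq_nat M (P ∩ D.ρ)
      rw [hk] at h ⊢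
      have h' : ((3 : ℕ) : ℕ∞) ≤ ((k + 1 : ℕ) : ℕ∞) := by push_cast; exact h
      have := (Nat.cast_le (α := ℕ∞)).1 h'
      exact_mod_cast (show 2 ≤ k by omega)
  refine ⟨hxL, htrace, hr2, ?_⟩
  -- not a class: `λ = λ_y` would give `P = Π_y ⊇ L`
  intro hcl
  unfold classes at hcl
  rw [Finset.mem_image] at hcl
  obtain ⟨y, hy, hlam⟩ := hcl
  rw [Finset.mem_sdiff] at hy
  have hPi := Pi_mem_planes hs hG h2 (D.ρ_subset hy.1) hy.2
  have hsub : P ∩ G ⊆ D.Pi y := by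
    rw [htrace]
    apply Finset.insert_subset (hPi.2 (Finset.mem_insert_of_mem hxL))
    rw [← hlam]
    unfold lam
    exact Finset.inter_subset_left
  have hPeq : P = D.Pi y := planes_eq_of_subset hP hPi.1 Finset.inter_subset_left hsub h3
  -- then `L ⊆ P`, contradicting `P ∩ L = {x}` with `|L| ≥ 2`
  have hLP : D.L ⊆ P := by
    rw [hPeq]
    exact (Finset.subset_insert y D.L).trans hPi.2
  have : P ∩ D.L = D.L := Finset.inter_eq_right.2 hLP
  rw [hL] at this
  have hc := congrArg Finset.card this
  rw [Finset.card_singleton] at hc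
  omega

/-- **The plane list (22.12.2 (a))**: every plane of `M` with a rank-`3` trace is `P₀`, a `Π_y`, or has trace
`{x} ∪ λ` with `x ∈ L` and `λ = P ∩ ρ` a non-class line trace of `ρ`. -/
theorem plane_trichotomy (hs : Simple M) (hG : G ⊆ gr M) (h2 : 2 ≤ D.L.card) {P : Finset α}
    (hP : P ∈ planes M) (h3 : M.eRk ((P ∩ G : Finset α) : Set α) = 3) :
    P = D.P₀ ∨ (∃ y ∈ D.ρ \ D.ellF, P = D.Pi y) ∨
      (∃ x ∈ D.L, P ∩ G = insert x (P ∩ D.ρ) ∧ M.eRk ((P ∩ D.ρ : Finset α) : Set α) = 2 ∧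
        P ∩ D.ρ ∉ D.classes) := by
  rcases Nat.lt_or_ge (P ∩ D.L).card 2 with hlt | hge
  · rcases Nat.lt_or_ge (P ∩ D.L).card 1 with h0 | h1
    · left
      exact plane_eq_P₀_of_inter_L_empty hP h3 (Finset.card_eq_zero.1 (by omega))
    · right; right
      obtain ⟨x, hx⟩ := Finset.card_eq_one.1 (by omega : (P ∩ D.L).card = 1)
      obtain ⟨hxL, htrace, hr2, hncl⟩ := plane_trace_of_inter_L_singleton hs hG h2 hP h3 hx
      exact ⟨x, hxL, htrace, hr2, hncl⟩
  · right; left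
    exact plane_eq_Pi_of_two_le hs hG h2 hP h3 hge

end PLData

end PercRepro.SixFour
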